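import Summits.Parity.GeneralizedHardyLittlewood.Theorems.LeeYangFibresRelativeDimOneTypeDataC
import Summits.Parity.GeneralizedHardyLittlewood.Theorems.LeeYangFibresRelativeDimOneTypeDataD
import Summits.Parity.GeneralizedHardyLittlewood.Theorems.LeeYangFibresRelativeDimOneTypeDataE
import HarnessLib

/-!
# Type data for the reshaped line `gallagher-backwards-split` (crux stmt-Parity-14113
`LeeYangFibres.RelativeDimOne`): `stub_typeData`

`stub_typeData : TypeClassMoments θ₁ → SingularWeightFacts → TypeRigidity → TypeData θ` for all `0 < θ < 1`,
`0 < θ₁` — the DICTIONARY of the type-conditioned split. For the core's spectrum `f` at scale `N`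
(type-invariant, decay `C`, reproducing every `S(Ψ, K)` with `‖Ψ‖_N ≤ L₁ = t((2L+2)^t + L + 1)` to accuracy `ε`),
the type-conditioned density `condSum ⌊N^θ⌋ w a b₀ (f a)` at a non-degenerate target equals the local singular
factor `∏_{p ≤ w} β_p(a, b₀)`, `w = ⌊log₄ N⌋ / D`, up to `η G_w(a, b₀)`, for every `D ≥ D₀ = ⌈1/θ₁⌉ + ⌈2/(1−θ)⌉ + 1`.

Proof (parts A–E of this series): sum the core clause over the shifts `b` of the data box
`∏_i [(2L+2)^{i+1} N, (2L+2)^{i+1} N + N]` (all non-degenerate) lying in the type cell of `b₀` modulo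
`P = ∏_{p ≤ w} p ≤ N^{1/D} ≤ N^{θ₁}` (window `[0, N)`, `β_∞ = N − 1`). PRIME SIDE (`prime_side`): by the landed
`dictionary_identity` on each residue class of the cell the prime-tuple sums are the type-class moving moments,
evaluated by `TypeClassMoments` at the modulus `P`; the coprime-pair count is `N #cell φ(P)^t λ / P^t`,
`λ = ∏_{p ≤ w} β_p` by (W5). SPECTRUM SIDE (`spectrum_side`): each `f a q` is `q`-periodic and the cell is
`P`-periodic; block summation modulo `P q₂` (`q₂` the `w`-rough part of `q`, `P q₂ ≤ N^{1/D + θ} = o(N)`) and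
the Chinese remainder theorem on type cells give `Σ_{cell ∩ box} f a q = #cell ((N+1)/P)^t condAvg_q (1 + O(qP/N))`
with errors controlled through `Σ_q condAvg_q |f a q| ≤ 2 C G_w` (R3 of `TypeRigidity`). COMBINATION (`combine`).
-/

noncomputable section

open scoped BigOperators Classical ArithmeticFunction.vonMangoldt
open Finset Filter Literature.NumberTheory.Sieve
open Summit.Parity.GeneralizedHardyLittlewood.Cruxes.RelativeDimOne.GallagherBackwards (classPsi)
open Summit.Parity.GeneralizedHardyLittlewood.Cruxes.RelativeDimOne.GallagherBackwardsSplit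

namespace Summit.Parity.GeneralizedHardyLittlewood.Cruxes.RelativeDimOne.TypeSplit

namespace TypeDataProof

variable {t : ℕ}

/-- `∏_{p ≤ w} p ≤ N` for `w = ⌊log₄ N⌋ / D`, `N, D ≥ 1`. -/
theorem primorial_wlev_le {N D : ℕ} (hN : 1 ≤ N) (hD : 1 ≤ D) : primorial (wlev D N) ≤ N := by
  calc primorial (wlev D N) ≤ primorial (wlev D N) ^ D := Nat.le_self_pow (by omega) _
    _ ≤ (4 ^ wlev D N) ^ D := Nat.pow_le_pow_left (primorial_le_four_pow _) D
    _ = 4 ^ (wlev D N * D) := by rw [← pow_mul]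
    _ ≤ 4 ^ Nat.log 4 N := Nat.pow_le_pow_right (by norm_num) (Nat.div_mul_le_self _ _)
    _ ≤ N := Nat.pow_log_le_self 4 (by omega)

/-! ### The prime side -/

/-- PRIME SIDE of the type-conditioned dictionary: with `x = (N+1)/P`, `K = #typeCell P P a b₀`,
`λ_P = ∏_{p ∣ P} β_p(a, b₀)`, the prime-tuple sums over the shifts of the data box in the cell total
`x^t K N λ_P` up to `ε₁ x^t K N (λ_P + 1)` (dictionary identity + `TypeClassMoments` at `q = P` + (W5)). -/
theorem prime_side {θ₁ ε₁ : ℝ} {L N P : ℕ} (hP : 1 ≤ P) (hPsq : Squarefree P)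
    (hPN : (P : ℝ) ≤ (N : ℝ) ^ θ₁)
    (hTCM : ∀ q : ℕ, 1 ≤ q → Squarefree q → (q : ℝ) ≤ (N : ℝ) ^ θ₁ →
      ∀ a b₀ u : Fin t → ℤ, (∀ i, a i ≠ 0 ∧ |a i| ≤ ((2 * L + 2) ^ t + L + 1 : ℕ)) →
        ∀ X : Fin t → ℕ, (∀ i, 1 * N ≤ (X i : ℝ)) →
          ∀ W : ℕ, (1 : ℝ) * N ≤ W →
            (∀ i, ∀ n : ℕ, n < W →
              1 * N + 1 ≤ ((a i * n + u i : ℤ) : ℝ) ∧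
                ((a i * n + u i + X i : ℤ) : ℝ) ≤ ((2 * L + 2) ^ t + L + 1 : ℕ) * N) →
            |(∑ n ∈ Finset.range W, ∑ c ∈ typeCell q q a b₀,
                ∏ i, (classPsi (a i * n + u i + X i).toNat q (resid q (a i * n + c i))
                      - classPsi (a i * n + u i - 1).toNat q (resid q (a i * n + c i))))
              - (∏ i, ((X i : ℝ) + 1)) / (Nat.totient q : ℝ) ^ t * (coprimePairs q a b₀ W : ℝ)|
              ≤ ε₁ * (∏ i, ((X i : ℝ) + 1)) *
                  ((coprimePairs q a b₀ W : ℝ) / (Nat.totient q : ℝ) ^ t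
                    + W * ((typeCell q q a b₀).card : ℝ) / (q : ℝ) ^ t))
    (hW5 : ∀ (t q : ℕ), 1 ≤ q → Squarefree q → ∀ a b₀ : Fin t → ℤ, (∀ i, a i ≠ 0) → ∀ n : ℕ,
      ((((typeCell q q a b₀).filter (fun c => ∀ i, Int.gcd (a i * n + c i) q = 1)).card : ℕ) : ℝ)
          * (q : ℝ) ^ t
        = ((typeCell q q a b₀).card : ℝ) * (Nat.totient q : ℝ) ^ t * localTypeFactor q a b₀)
    {a : Fin t → ℤ} (ha : ∀ i, a i ≠ 0 ∧ |a i| ≤ L) (b₀ : Fin t → ℤ) :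
    |∑ b ∈ (box (fun i => (((2 * L + 2) ^ (i.val + 1) * N : ℕ) : ℤ)) (fun _ => N)).filter
          (fun b => ∀ p ∈ P.primeFactors, incType p a b = incType p a b₀),
          ∑ n ∈ range N, ∏ i, Λ ((a i * n + b i).toNat)
        - ((((N + 1 : ℕ)) : ℝ) / P) ^ t * ((typeCell P P a b₀).card : ℝ) * N * localTypeFactor P a b₀|
      ≤ ε₁ * (((((N + 1 : ℕ)) : ℝ) / P) ^ t * ((typeCell P P a b₀).card : ℝ) * N
          * (localTypeFactor P a b₀ + 1)) := by
  have hP0 : 0 < P := hP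
  have ha' : ∀ i, a i ≠ 0 ∧ |a i| ≤ ((2 * L + 2) ^ t + L + 1 : ℕ) := fun i =>
    ⟨(ha i).1, (ha i).2.trans (by exact_mod_cast (show L ≤ (2 * L + 2) ^ t + L + 1 by omega))⟩
  have hpos : ∀ i, ∀ n : ℕ, n < N → 1 ≤ a i * n + (((2 * L + 2) ^ (i.val + 1) * N : ℕ) : ℤ) := by
    intro i n hn
    have := (heights_of_window (t := t) ha i n hn).1
    push_cast at this ⊢
    nlinarith
  have e1 := primeSide_identity hP0 a b₀ (fun i => (((2 * L + 2) ^ (i.val + 1) * N : ℕ) : ℤ))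
    (fun _ => N) N hpos
  have hT := hTCM P hP hPsq hPN a b₀ (fun i => (((2 * L + 2) ^ (i.val + 1) * N : ℕ) : ℤ)) ha'
    (fun _ => N) (fun i => by simp) N (by simp) (heights_real ha)
  -- the main term and the error term
  have hφ : (0 : ℝ) < (Nat.totient P : ℝ) := by exact_mod_cast Nat.totient_pos.2 hP0
  have hP' : (0 : ℝ) < (P : ℝ) := by exact_mod_cast hP0
  have hprod : (∏ _i : Fin t, ((N : ℝ) + 1)) = (((N + 1 : ℕ)) : ℝ) ^ t := by
    rw [Finset.prod_const, Finset.card_univ, Fintype.card_fin]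
    push_cast
    ring
  have hcp : (coprimePairs P a b₀ N : ℝ) =
      N * (((typeCell P P a b₀).card : ℝ) * (Nat.totient P : ℝ) ^ t * localTypeFactor P a b₀)
        / (P : ℝ) ^ t := by
    rw [eq_div_iff (by positivity)]
    exact coprimePairs_mul_eq hW5 hP hPsq a b₀ (fun i => (ha i).1) N
  have hmain : (∏ _i : Fin t, ((N : ℝ) + 1)) / (Nat.totient P : ℝ) ^ t * (coprimePairs P a b₀ N : ℝ) =
      ((((N + 1 : ℕ)) : ℝ) / P) ^ t * ((typeCell P P a b₀).card : ℝ) * N * localTypeFactor P a b₀ := by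
    rw [hprod, hcp, div_pow]
    field_simp
  have herr : ε₁ * (∏ _i : Fin t, ((N : ℝ) + 1)) *
      ((coprimePairs P a b₀ N : ℝ) / (Nat.totient P : ℝ) ^ t
        + N * ((typeCell P P a b₀).card : ℝ) / (P : ℝ) ^ t) =
      ε₁ * (((((N + 1 : ℕ)) : ℝ) / P) ^ t * ((typeCell P P a b₀).card : ℝ) * N
          * (localTypeFactor P a b₀ + 1)) := by
    rw [hprod, hcp, div_pow]
    field_simp
  rw [e1, ← hmain, ← herr]
  exact hT

/-! ### The spectrum side -/

/-- SPECTRUM SIDE of the type-conditioned dictionary: for a type-invariant spectrum `e`, with `P = ∏_{p ≤ w} p`,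
`x = (N+1)/P`, `K = #typeCell P P a b₀`, `R = Σ_{q ≤ Q sqfree} condAvg_q |e q|`:
`|Σ_{cell ∩ box} sfBand Q e − K x^t condSum Q w a b₀ e| ≤ 2 t K Q (x + Q)^{t−1} R` and
`Σ_{cell ∩ box} |sfBand Q e| ≤ K (x + Q)^t R`. -/
theorem spectrum_side (L N w Q : ℕ) {a : Fin t → ℤ} (b₀ : Fin t → ℤ) {e : ℕ → (Fin t → ℤ) → ℝ}
    (he : TypeInvariant a e) :
    |∑ b ∈ (box (fun i => (((2 * L + 2) ^ (i.val + 1) * N : ℕ) : ℤ)) (fun _ => N)).filter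
          (fun b => ∀ p ∈ (primorial w).primeFactors, incType p a b = incType p a b₀), sfBand Q e b
        - ((typeCell (primorial w) (primorial w) a b₀).card : ℝ) *
            ((((N + 1 : ℕ)) : ℝ) / (primorial w : ℕ)) ^ t * condSum Q w a b₀ e|
      ≤ 2 * t * ((typeCell (primorial w) (primorial w) a b₀).card : ℝ) * (Q : ℝ) *
          ((((N + 1 : ℕ)) : ℝ) / (primorial w : ℕ) + Q) ^ (t - 1) *
            ∑ q ∈ (Finset.Icc 1 Q).filter Squarefree, condAvg q w a b₀ (fun b => |e q b|) ∧
    ∑ b ∈ (box (fun i => (((2 * L + 2) ^ (i.val + 1) * N : ℕ) : ℤ)) (fun _ => N)).filter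
          (fun b => ∀ p ∈ (primorial w).primeFactors, incType p a b = incType p a b₀), |sfBand Q e b|
      ≤ ((typeCell (primorial w) (primorial w) a b₀).card : ℝ) *
          ((((N + 1 : ℕ)) : ℝ) / (primorial w : ℕ) + Q) ^ t *
            ∑ q ∈ (Finset.Icc 1 Q).filter Squarefree, condAvg q w a b₀ (fun b => |e q b|) := by
  have hP0 : 0 < primorial w := primorial_pos w
  have hK0 : (0 : ℝ) ≤ ((typeCell (primorial w) (primorial w) a b₀).card : ℝ) := Nat.cast_nonneg _
  -- per modulus
  have hper : ∀ q ∈ (Finset.Icc 1 Q).filter Squarefree,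
      |∑ b ∈ (box (fun i => (((2 * L + 2) ^ (i.val + 1) * N : ℕ) : ℤ)) (fun _ => N)).filter
            (fun b => ∀ p ∈ (primorial w).primeFactors, incType p a b = incType p a b₀), e q b
          - ((typeCell (primorial w) (primorial w) a b₀).card : ℝ) *
              ((((N + 1 : ℕ)) : ℝ) / (primorial w : ℕ)) ^ t * condAvg q w a b₀ (e q)|
        ≤ 2 * t * ((typeCell (primorial w) (primorial w) a b₀).card : ℝ) * (Q : ℝ) *
            ((((N + 1 : ℕ)) : ℝ) / (primorial w : ℕ) + Q) ^ (t - 1) * condAvg q w a b₀ (fun b => |e q b|) ∧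
      ∑ b ∈ (box (fun i => (((2 * L + 2) ^ (i.val + 1) * N : ℕ) : ℤ)) (fun _ => N)).filter
            (fun b => ∀ p ∈ (primorial w).primeFactors, incType p a b = incType p a b₀), |e q b|
        ≤ ((typeCell (primorial w) (primorial w) a b₀).card : ℝ) *
            ((((N + 1 : ℕ)) : ℝ) / (primorial w : ℕ) + Q) ^ t * condAvg q w a b₀ (fun b => |e q b|) := by
    intro q hq
    rw [mem_filter, mem_Icc] at hq
    obtain ⟨⟨hq1, hqQ⟩, hsq⟩ := hq
    obtain ⟨hq₂1, hq₂q, hdvd⟩ := rough_part_facts w hq1 hsq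
    have hq₂Q : ((q / Nat.gcd q (primorial w) : ℕ) : ℝ) ≤ (Q : ℝ) := by exact_mod_cast hq₂q.trans hqQ
    have hpq : ∀ b b' : Fin t → ℤ, (∀ i, b i ≡ b' i [ZMOD q]) → e q b = e q b' :=
      fun b b' h => typeInvariant_periodic he hsq h
    have hpq' : ∀ b b' : Fin t → ℤ, (∀ i, b i ≡ b' i [ZMOD q]) → |e q b| = |e q b'| :=
      fun b b' h => by rw [hpq b b' h]
    have hpM : ∀ b b' : Fin t → ℤ,
        (∀ i, b i ≡ b' i [ZMOD (primorial w * (q / Nat.gcd q (primorial w)) : ℕ)]) → e q b = e q b' :=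
      fun b b' h => hpq b b' fun i => (h i).of_dvd (Int.natCast_dvd_natCast.2 hdvd)
    have hpM' : ∀ b b' : Fin t → ℤ,
        (∀ i, b i ≡ b' i [ZMOD (primorial w * (q / Nat.gcd q (primorial w)) : ℕ)]) → |e q b| = |e q b'| :=
      fun b b' h => by rw [hpM b b' h]
    have HA := cell_residue_sum w hq1 hsq a b₀ (e q) hpq
    have HA' := cell_residue_sum w hq1 hsq a b₀ (fun b => |e q b|) hpq'
    exact ⟨cell_sum_modulus hP0 hq₂1 hq₂Q a b₀ (e q) hpM hK0 (abs_condAvg_le q w a b₀ (e q)) HA HA',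
      cell_abs_sum_le hP0 hq₂1 hq₂Q a b₀ (e q) hpM hK0 (condAvg_abs_nonneg q w a b₀ (e q)) HA'⟩
  constructor
  · -- swap the sums and add up the per-modulus estimates
    unfold sfBand condSum
    rw [Finset.sum_comm, Finset.mul_sum, ← Finset.sum_sub_distrib, Finset.mul_sum]
    refine (Finset.abs_sum_le_sum_abs _ _).trans (Finset.sum_le_sum fun q hq => (hper q hq).1)
  · unfold sfBand
    calc ∑ b ∈ (box (fun i => (((2 * L + 2) ^ (i.val + 1) * N : ℕ) : ℤ)) (fun _ => N)).filter
            (fun b => ∀ p ∈ (primorial w).primeFactors, incType p a b = incType p a b₀),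
            |∑ q ∈ (Finset.Icc 1 Q).filter Squarefree, e q b|
        ≤ ∑ b ∈ (box (fun i => (((2 * L + 2) ^ (i.val + 1) * N : ℕ) : ℤ)) (fun _ => N)).filter
            (fun b => ∀ p ∈ (primorial w).primeFactors, incType p a b = incType p a b₀),
            ∑ q ∈ (Finset.Icc 1 Q).filter Squarefree, |e q b| :=
          Finset.sum_le_sum fun b _ => Finset.abs_sum_le_sum_abs _ _
      _ = ∑ q ∈ (Finset.Icc 1 Q).filter Squarefree,
            ∑ b ∈ (box (fun i => (((2 * L + 2) ^ (i.val + 1) * N : ℕ) : ℤ)) (fun _ => N)).filter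
              (fun b => ∀ p ∈ (primorial w).primeFactors, incType p a b = incType p a b₀), |e q b| :=
          Finset.sum_comm
      _ ≤ ∑ q ∈ (Finset.Icc 1 Q).filter Squarefree,
            ((typeCell (primorial w) (primorial w) a b₀).card : ℝ) *
              ((((N + 1 : ℕ)) : ℝ) / (primorial w : ℕ) + Q) ^ t * condAvg q w a b₀ (fun b => |e q b|) :=
          Finset.sum_le_sum fun q hq => (hper q hq).2
      _ = _ := by rw [← Finset.mul_sum]

end TypeDataProof

open TypeDataProof in
/-- PROVABLE (XL), now PROVED: the type data — the dictionary over a type cell, evaluated by `TypeClassMoments` on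
the prime side and by residue counting on the spectrum side. -/
theorem stub_typeData : ∀ θ θ₁ : ℝ, 0 < θ → θ < 1 → 0 < θ₁ → TypeClassMoments θ₁ → SingularWeightFacts → TypeRigidity → TypeData θ := by
  intro θ θ₁ hθ hθ1 hθ₁ hTCM hSWF hTR t L ht
  obtain ⟨-, -, -, hW5⟩ := hSWF
  refine ⟨⌈1 / θ₁⌉₊ + ⌈2 / (1 - θ)⌉₊ + 1, t * ((2 * L + 2) ^ t + L + 1), ?_, ?_⟩
  · calc L ≤ (2 * L + 2) ^ t + L + 1 := by omega
      _ = 1 * ((2 * L + 2) ^ t + L + 1) := (one_mul _).symm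
      _ ≤ t * ((2 * L + 2) ^ t + L + 1) := Nat.mul_le_mul_right _ ht
  intro D hD C η hC hη
  have hD1 : 1 ≤ D := le_trans (Nat.le_add_left 1 _) hD
  have hDpos : (0 : ℝ) < D := by exact_mod_cast hD1
  have hDθ₁ : 1 / (D : ℝ) ≤ θ₁ := by
    have h1 : (⌈1 / θ₁⌉₊ : ℝ) ≤ D := by exact_mod_cast (show ⌈1 / θ₁⌉₊ ≤ D by omega)
    have h2 : 1 / θ₁ ≤ (⌈1 / θ₁⌉₊ : ℝ) := Nat.le_ceil _
    have h3 : 1 / θ₁ ≤ D := h2.trans h1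
    rw [div_le_iff₀ hθ₁] at h3
    rw [div_le_iff₀ hDpos]
    linarith
  have hDθ : 1 / (D : ℝ) ≤ (1 - θ) / 2 := by
    have h1 : (⌈2 / (1 - θ)⌉₊ : ℝ) ≤ D := by exact_mod_cast (show ⌈2 / (1 - θ)⌉₊ ≤ D by omega)
    have h2 : 2 / (1 - θ) ≤ (⌈2 / (1 - θ)⌉₊ : ℝ) := Nat.le_ceil _
    have h3 : 2 / (1 - θ) ≤ D := h2.trans h1
    rw [div_le_iff₀ (by linarith)] at h3
    rw [div_le_iff₀ hDpos]
    linarith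
  -- the accuracy asked of the core
  refine ⟨η / (2 ^ (t + 3) * (C + 1)), by positivity, ?_⟩
  -- thresholds
  obtain ⟨N₁, hN₁⟩ := hTCM t ((2 * L + 2) ^ t + L + 1) ht 1 (η / 16) one_pos (by positivity)
  obtain ⟨N₂, hN₂⟩ := hTR t L D C 1 ht hD1 hC one_pos
  have hγ : 0 < (1 - θ) / 2 := by linarith
  have hcpos : 0 < η / (4 * (t * 2 ^ (t + 1) * C + 1)) := by positivity
  have hev : ∀ᶠ N : ℕ in atTop,
      (N : ℝ) ^ (-((1 - θ) / 2)) ≤ η / (4 * (t * 2 ^ (t + 1) * C + 1)) ∧ 4 / η + 2 ≤ (N : ℝ) :=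
    (((tendsto_rpow_neg_atTop hγ).comp tendsto_natCast_atTop_atTop).eventually_le_const hcpos).and
      (tendsto_natCast_atTop_atTop.eventually_ge_atTop _)
  obtain ⟨N₃, hN₃⟩ := Filter.eventually_atTop.1 hev
  refine ⟨N₁ + N₂ + N₃ + 2, ?_⟩
  intro N hN f hTI hHD hCore a b₀ ha hb₀ hnd
  have hNN₁ : N₁ ≤ N := by omega
  have hNN₂ : N₂ ≤ N := by omega
  have hN1 : 1 ≤ N := by omega
  obtain ⟨hNc, hNη⟩ := hN₃ N (by omega)
  have hNr1 : (1 : ℝ) ≤ N := by exact_mod_cast hN1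
  have hNr2 : (2 : ℝ) ≤ N := by exact_mod_cast (show 2 ≤ N by omega)
  -- the cell modulus and the level
  have hP0 : 0 < primorial (wlev D N) := primorial_pos _
  have hPsq : Squarefree (primorial (wlev D N)) := squarefree_primorial _
  have hPθ₁ : ((primorial (wlev D N) : ℕ) : ℝ) ≤ (N : ℝ) ^ θ₁ :=
    (primorial_wlev_le_rpow hN1 hD1).trans (Real.rpow_le_rpow_of_exponent_le hNr1 hDθ₁)
  have hPr : (0 : ℝ) < ((primorial (wlev D N) : ℕ) : ℝ) := by exact_mod_cast hP0
  have hx1 : (1 : ℝ) ≤ (((N + 1 : ℕ)) : ℝ) / (primorial (wlev D N) : ℕ) := by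
    rw [le_div_iff₀ hPr, one_mul]
    exact_mod_cast (primorial_wlev_le hN1 hD1).trans (Nat.le_succ N)
  have hQP := level_mul_primorial_le (θ := θ) hN1 hD1 hDθ
  have hNγ1 : (N : ℝ) ^ (-((1 - θ) / 2)) ≤ 1 :=
    Real.rpow_le_one_of_one_le_of_nonpos hNr1 (by linarith)
  have hQx : ((level θ N : ℕ) : ℝ) ≤ (((N + 1 : ℕ)) : ℝ) / (primorial (wlev D N) : ℕ) := by
    rw [le_div_iff₀ hPr]
    calc ((level θ N : ℕ) : ℝ) * ((primorial (wlev D N) : ℕ) : ℝ)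
        ≤ (((N + 1 : ℕ)) : ℝ) * (N : ℝ) ^ (-((1 - θ) / 2)) := hQP
      _ ≤ (((N + 1 : ℕ)) : ℝ) * 1 := by gcongr
      _ = _ := mul_one _
  have hδ : (t : ℝ) * 2 ^ (t + 1) * C * ((level θ N : ℕ) : ℝ) ≤
      η / 4 * ((((N + 1 : ℕ)) : ℝ) / (primorial (wlev D N) : ℕ)) := by
    have hQc : ((level θ N : ℕ) : ℝ) ≤
        η / (4 * (t * 2 ^ (t + 1) * C + 1)) * ((((N + 1 : ℕ)) : ℝ) / (primorial (wlev D N) : ℕ)) := by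
      rw [← mul_div_assoc, le_div_iff₀ hPr]
      calc ((level θ N : ℕ) : ℝ) * ((primorial (wlev D N) : ℕ) : ℝ)
          ≤ (((N + 1 : ℕ)) : ℝ) * (N : ℝ) ^ (-((1 - θ) / 2)) := hQP
        _ ≤ (((N + 1 : ℕ)) : ℝ) * (η / (4 * (t * 2 ^ (t + 1) * C + 1))) := by gcongr
        _ = _ := mul_comm _ _
    have hA : (t : ℝ) * 2 ^ (t + 1) * C * (η / (4 * (t * 2 ^ (t + 1) * C + 1))) ≤ η / 4 := by
      rw [show (t : ℝ) * 2 ^ (t + 1) * C * (η / (4 * (t * 2 ^ (t + 1) * C + 1)))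
          = η / 4 * ((t * 2 ^ (t + 1) * C) / (t * 2 ^ (t + 1) * C + 1)) by field_simp]
      have h1 : ((t : ℝ) * 2 ^ (t + 1) * C) / (t * 2 ^ (t + 1) * C + 1) ≤ 1 :=
        (div_le_one (by positivity)).2 (by linarith)
      calc η / 4 * ((t * 2 ^ (t + 1) * C) / (t * 2 ^ (t + 1) * C + 1)) ≤ η / 4 * 1 := by gcongr
        _ = η / 4 := mul_one _
    calc (t : ℝ) * 2 ^ (t + 1) * C * ((level θ N : ℕ) : ℝ)
        ≤ (t : ℝ) * 2 ^ (t + 1) * C *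
            (η / (4 * (t * 2 ^ (t + 1) * C + 1)) * ((((N + 1 : ℕ)) : ℝ) / (primorial (wlev D N) : ℕ))) :=
          mul_le_mul_of_nonneg_left hQc (by positivity)
      _ = (t : ℝ) * 2 ^ (t + 1) * C * (η / (4 * (t * 2 ^ (t + 1) * C + 1))) *
            ((((N + 1 : ℕ)) : ℝ) / (primorial (wlev D N) : ℕ)) := by ring
      _ ≤ η / 4 * ((((N + 1 : ℕ)) : ℝ) / (primorial (wlev D N) : ℕ)) :=
          mul_le_mul_of_nonneg_right hA (by positivity)
  -- the five inputs
  have h1 := prime_side (t := t) hP0 hPsq hPθ₁ (hN₁ N hNN₁) hW5 ha b₀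
  rw [localTypeFactor_primorial] at h1
  obtain ⟨h2, h3⟩ := spectrum_side L N (wlev D N) (level θ N) b₀ (hTI a)
  have h4 := cell_count_le (L := L) (N := N) hP0 a b₀
  have h5 := core_summed (θ := θ) hN1 hCore ha _
    (Finset.filter_subset (fun b => ∀ p ∈ (primorial (wlev D N)).primeFactors,
      incType p a b = incType p a b₀) _)
  have hR3 := (hN₂ N hNN₂ (level θ N) a ha (f a) (hTI a) (hHD a) b₀ hb₀ hnd).2.2
  -- combine
  have hK : (0 : ℝ) < ((typeCell (primorial (wlev D N)) (primorial (wlev D N)) a b₀).card : ℝ) := by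
    exact_mod_cast typeCell_self_card_pos hP0 a b₀
  have hR0 : 0 ≤ ∑ q ∈ (Finset.Icc 1 (level θ N)).filter Squarefree,
      condAvg q (wlev D N) a b₀ (fun b => |f a q b|) :=
    Finset.sum_nonneg fun q _ => condAvg_abs_nonneg q _ a b₀ _
  have hNη' : 4 ≤ η * ((N : ℝ) - 1) := by
    have h1 : 4 / η ≤ (N : ℝ) - 1 := by linarith
    rw [div_le_iff₀ hη] at h1
    linarith
  exact combine ht hK hx1 (Nat.cast_nonneg _) hQx hNr2 (by positivity) (by positivity)
    (EndgameProof.one_le_gscale _ a b₀) (singularProductPartial_nonneg _ a b₀) (singularProductPartial_le_gscale _ a b₀)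
    hR0 (by linarith [hR3]) h1 h2 h3 h4 h5 (le_of_eq (by field_simp; ring)) hδ hNη' (le_of_eq (by ring))

end Summit.Parity.GeneralizedHardyLittlewood.Cruxes.RelativeDimOne.TypeSplit

end
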